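import Summits.CriticalPhenomena.PercolationContinuityZ3.Theorems.Transplant.SkelFrmBParamsFaceFloorsAYA
import Summits.CriticalPhenomena.PercolationContinuityZ3.Theorems.Transplant.PlanarSkeletonFrmDefs
import Summits.CriticalPhenomena.PercolationContinuityZ3.Theorems.Transplant.SkelPhiStepIDataNS
import HarnessLib
/-!
(F) VALUE LAYER, N2 twin (hp-8 g42, 2026-08-23; F-DISCHARGE-MAP-N2 G18; (R-22)/E6): `port_frm.py` text of N1 `SkelNegBParamsFaceFloorsFBYA` (stmt-g16) — y′-face transverse floors FA5/FA6 over AYA-N2 (generic PCells2T, CREEP-AWARE fw = 5r_i − 7 − c icr − |z i − cenS x i|; yBnd_env_Y);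
kit radius `RA′ ↦ KS0.R'0`; floors in R'0 stay hypotheses; proofs otherwise verbatim.
NON-VACUITY: arithmetic under `EqNumL`, `|h_L| ≤ 10n_L`, the run-position hypotheses and the n_L/ℓ_L floors.
builds on p205010 (kernel theorem, internal audit signed; external expert review pending); nothing here is a claim about the open node `SamePDropOfSkeletonFrm₁`.
N1 HEADER (kept for the reader):
# N1 params, M3 y′-FACE, group G-A′ part 2 — **THE y′-FACE's ALONG y′-RUN TRANSVERSE FLOORS `FA5`/`FA6`** (fields `Skelφ.FloorsY2.FA5/FA6`, SkelPhiFaceNumsYP2) at the (ζ′)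
# tuple in M3-FLOORS-SIGNATURE form (`pr := prFA`: `coarse c₁ (D/2) D (lam1 A n_L h_L y) = KS.F1cA y`, `coarse c₀ (D/2) D (lam0 A v_L v_β y) = KS.FcA y` (rfl);
# `P := fcellsA`, `κ₀ := u₀A`, `κ₁ := u₁A`, `mod := m`, `Vb := n_L`, `ℓ' := ℓ_L`, `R's := RA′ mk`, `k₀ := 3`), the y′-face's START HALF-HEIGHT `qB` (hp-8 g36's separate
# binder `qB′`, (F) chain v9, lane INBOX 2026-08-22T09:07:47Z) GENERIC under the one budget hypothesis **`hqB : 4·(U_L·qB) ≤ 5·(n_L·ℓ_L)`** (met by the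
# `qBY`-type start windows: `U·qBY ≤ n_Lℓ_L/2 + n_L·(10·S_F + 11RA′ + 74)` and `16·S_F ≤ M_L < ℓ_L`), for the y′-face (`du.1 = 1`: along axis `1`, habitat
# `[flo, fhi] = [5r₁ + 10u₁j + 3 − lev, 25r₁ − 2 − lev]`; transverse axis `i = 0`, room `fw = 5r_i − 7 − |z_i − cen_i|`), along sign `σ = sgOf du = ±1`:
# * (part 1, `…FloorsFAYA`) the along floors `FA1_YA`–`FA4_YA`;
# * HERE: the transverse correlation bound **`yBnd_env_Y`**: `u·(yBnd(qB, RA′, k) + 2n_L) ≤ 9·u·(n_L·m)` (`k + 1 ≤ 1000·Kq`, `2000·Kq·(RA′+2) ≤ n_L`,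
#   `22000·Kq·(RA′+2) ≤ ℓ_L`) ⇒ **`FA5_YA`/`FA6_YA`** from `hlo : −fw + 9u₀ + 1 ≤ FcA yL`, `hhi : FcA yL + 9u₀ + 1 ≤ fw` (the along y′-run does not move
#   transversally in the reading `FcA`; band room e.g. `KS.hkE24_RA₂` in `…FloorsFTYA`).
# (stmt-g17 2026-08-22; y′-face split hp-8 g36 08:48:44Z / lead (g8) 09:10:59Z: G-A′ = stmt-g17.)
builds on p205010 (kernel theorem, internal audit signed; external expert review pending) — nothing in this file uses p205010; NOTHING is claimed about the node
`SamePDropOfSkeletonNeg₁` (OPEN); arithmetic only.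
Lane `prim-bschramm-*`, seat `prim-bschramm-stmt` (gen 17); helper file (`--supports stmt-CriticalPhenomena-4575 --as helper`); slot-ledger ζ′ v2.
[cite: KozmaNitzan2024, §4 Lemma 12 (pp. 23–25)] [cite: MartineauTassion2017, §4.1]
-/

noncomputable section

open scoped Classical

namespace Summit.CriticalPhenomena.PercolationContinuityZ3.Theorems.Transplant

namespace PlanarSkeletonFrm

namespace NegB

open Literature.Probability.Percolation Literature.Probability.LatticeModels SimpleGraph
open SkelConc (Consts)
open Skelφ (shearUnit shearUnit_pos yBoxLoS yBoxHiS ySLo ySHi yBnd)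
open Skelφ.StepI (DataN)
open TwoAxis.Para (modulus)
open Neg

namespace KS

section FloorsBY

/-! ## §1 The correlation bound's size at the y′-face tuple -/

/-- **The transverse correlation bound's size at the y′-face tuple**: `u·(yBnd(qB, RA′, k) + 2n_L) ≤ 9·u·(n_L·m)` for `k + 1 ≤ 1000·Kq` and `0 ≤ u`, under
`4·(U·qB) ≤ 5·(n_Lℓ_L)`, `2000·Kq·(RA′+2) ≤ n_L`, `22000·Kq·(RA′+2) ≤ ℓ_L`, `|h_L| ≤ 10n_L`. [folklore] -/
theorem yBnd_env_Y (κ : Consts) {V : Type} [DecidableEq V] [Countable V] {G : SimpleGraph V} [G.LocallyFinite] (Φ : PlanarSkeletonFrm G) (t : V) (p : unitInterval) (D : Skelφ.StepI.DataNS V) (g : ℕ) (f : ℕ) (mk : ℕ) (hN : EqNumL κ Φ t p D g f) (hκ : (hL κ Φ t p D g f).natAbs ≤ 10 * nL κ Φ t p D g f)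
    (hnA : 2000 * Neg.Kq κ * (KS0.R'0 κ Φ t p D mk + 2) ≤ nL κ Φ t p D g f) (hℓ : 22000 * Neg.Kq κ * (KS0.R'0 κ Φ t p D mk + 2) ≤ ℓL κ Φ t p D g f) {qB : ℕ}
    (hqB : 4 * ((shearUnit (nL κ Φ t p D g f) (hL κ Φ t p D g f) : ℤ) * (qB : ℤ)) ≤ 5 * ((nL κ Φ t p D g f : ℤ) * ℓL κ Φ t p D g f))
    {k : ℕ} (hk : k + 1 ≤ 1000 * Neg.Kq κ) {u : ℤ} (hu : 0 ≤ u) :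
    u * (yBnd (nL κ Φ t p D g f) (ℓL κ Φ t p D g f) (hL κ Φ t p D g f) (modulus (nL κ Φ t p D g f) (hL κ Φ t p D g f) (vL κ Φ t p D g f) (vβL κ Φ t p D g f))
        qB (KS0.R'0 κ Φ t p D mk) k + 2 * (nL κ Φ t p D g f : ℤ)) ≤
      9 * (u * ((nL κ Φ t p D g f : ℤ) * modulus (nL κ Φ t p D g f) (hL κ Φ t p D g f) (vL κ Φ t p D g f) (vβL κ Φ t p D g f))) := by
  obtain ⟨hn1, hℓ1⟩ := one_le_of_eqNumL κ Φ t p D g f hN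
  have hmm := Skelφ.NegPrm.modulus_vβOf hn1 (hL κ Φ t p D g f) (ℓL κ Φ t p D g f) (vL κ Φ t p D g f)
  have e : vβL κ Φ t p D g f = Skelφ.NegPrm.vβOf (nL κ Φ t p D g f) (hL κ Φ t p D g f) (ℓL κ Φ t p D g f) (vL κ Φ t p D g f) := rfl
  rw [← e] at hmm
  obtain ⟨hm1, hm2⟩ := hmm
  obtain ⟨-, -, -, sLa⟩ := sY_spec κ Φ t p D g f hn1
  have hUe : (shearUnit (nL κ Φ t p D g f) (hL κ Φ t p D g f) : ℤ) = (nL κ Φ t p D g f : ℤ) + ((hL κ Φ t p D g f).natAbs : ℤ) := by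
    unfold Skelφ.shearUnit; push_cast; ring
  have h10 : (((hL κ Φ t p D g f).natAbs : ℕ) : ℤ) ≤ 10 * (nL κ Φ t p D g f : ℤ) := by exact_mod_cast hκ
  have hh0 : (0 : ℤ) ≤ ((hL κ Φ t p D g f).natAbs : ℤ) := Nat.cast_nonneg _
  have hℓ' : 22000 * (Neg.Kq κ : ℤ) * ((KS0.R'0 κ Φ t p D mk : ℤ) + 2) ≤ (ℓL κ Φ t p D g f : ℤ) := by exact_mod_cast hℓ
  have hnA' : 2000 * (Neg.Kq κ : ℤ) * ((KS0.R'0 κ Φ t p D mk : ℤ) + 2) ≤ (nL κ Φ t p D g f : ℤ) := by exact_mod_cast hnA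
  have hk' : (k : ℤ) + 1 ≤ 1000 * (Neg.Kq κ : ℤ) := by exact_mod_cast hk
  have hLa : yBnd (nL κ Φ t p D g f) (ℓL κ Φ t p D g f) (hL κ Φ t p D g f) (modulus (nL κ Φ t p D g f) (hL κ Φ t p D g f) (vL κ Φ t p D g f) (vβL κ Φ t p D g f))
        qB (KS0.R'0 κ Φ t p D mk) k =
      modulus (nL κ Φ t p D g f) (hL κ Φ t p D g f) (vL κ Φ t p D g f) (vβL κ Φ t p D g f) * (3 * (nL κ Φ t p D g f : ℤ) + ((k : ℤ) + 1) * (KS0.R'0 κ Φ t p D mk : ℕ)) +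
        (nL κ Φ t p D g f : ℤ) * (shearUnit (nL κ Φ t p D g f) (hL κ Φ t p D g f) : ℤ) *
          (2 * (k : ℤ) + (qB : ℕ) + ((k : ℤ) + 1) * (KS0.R'0 κ Φ t p D mk : ℕ) + (LaY κ Φ t p D g f : ℤ) + 2) := by
    unfold Skelφ.yBnd LaY; push_cast; ring
  rw [hLa]
  clear hLa hℓ hnA hk hκ e
  have hn : (1 : ℤ) ≤ (nL κ Φ t p D g f : ℤ) := by exact_mod_cast hn1
  have hKq : (1 : ℤ) ≤ (Neg.Kq κ : ℤ) := by exact_mod_cast Neg.one_le_Kq κ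
  have hR0 : (0 : ℤ) ≤ (KS0.R'0 κ Φ t p D mk : ℤ) := Nat.cast_nonneg _
  have hk0 : (0 : ℤ) ≤ (k : ℤ) := Nat.cast_nonneg _
  have hq0 : (0 : ℤ) ≤ ((qB : ℕ) : ℤ) := Nat.cast_nonneg _
  set U : ℤ := (shearUnit (nL κ Φ t p D g f) (hL κ Φ t p D g f) : ℤ)
  set n : ℤ := (nL κ Φ t p D g f : ℤ)
  set ℓ : ℤ := (ℓL κ Φ t p D g f : ℤ)
  set m := modulus (nL κ Φ t p D g f) (hL κ Φ t p D g f) (vL κ Φ t p D g f) (vβL κ Φ t p D g f)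
  set Q : ℤ := (Neg.Kq κ : ℤ)
  set R : ℤ := (KS0.R'0 κ Φ t p D mk : ℤ)
  set La : ℤ := (LaY κ Φ t p D g f : ℤ)
  have hU11 : U ≤ 11 * n := by rw [hUe]; linarith
  have hUn : n ≤ U := by rw [hUe]; linarith
  have hU0 : 0 ≤ U := by linarith
  have hm0 : 0 < m := by nlinarith
  have hQR : 0 ≤ Q * R := mul_nonneg (by linarith) hR0
  -- (a) `2·m·(k+1)·R ≤ m·n`
  have a0 : ((k : ℤ) + 1) * R ≤ (1000 * Q) * R := mul_le_mul_of_nonneg_right hk' hR0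
  have a1 : m * (2 * (((k : ℤ) + 1) * R)) ≤ m * n := mul_le_mul_of_nonneg_left (by nlinarith) hm0.le
  -- (b) the `U·(…)` block: `4·U·(2k + qB + (k+1)R + La + 2) ≤ 19nℓ + 48n`
  have b1 : (k : ℤ) * U ≤ (1000 * Q - 1) * (11 * n) := mul_le_mul (by linarith) hU11 hU0 (by linarith)
  have b2 : U * (((k : ℤ) + 1) * R) ≤ (11 * n) * ((1000 * Q) * R) := mul_le_mul hU11 a0 (mul_nonneg (by linarith) hR0) (by linarith)
  have key : n * (44000 * Q * (R + 2)) ≤ n * (2 * ℓ) := mul_le_mul_of_nonneg_left (by nlinarith) (by linarith)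
  have hB : 4 * (U * (2 * (k : ℤ) + (qB : ℕ) + ((k : ℤ) + 1) * R + La + 2)) ≤ 19 * (n * ℓ) + 48 * n := by
    have e1 : 4 * (U * (2 * (k : ℤ) + (qB : ℕ) + ((k : ℤ) + 1) * R + La + 2)) =
        8 * ((k : ℤ) * U) + 4 * (U * (qB : ℕ)) + 4 * (U * (((k : ℤ) + 1) * R)) + 4 * (U * La) + 8 * U := by ring
    rw [e1]; nlinarith
  have hB' : n * (4 * (U * (2 * (k : ℤ) + (qB : ℕ) + ((k : ℤ) + 1) * R + La + 2))) ≤ n * (19 * (n * ℓ) + 48 * n) :=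
    mul_le_mul_of_nonneg_left hB (by linarith)
  -- (c) `n·ℓ ≤ m + n`, `80·n ≤ m`
  have c1 : n * (n * ℓ) ≤ n * (m + n) := mul_le_mul_of_nonneg_left (by linarith) (by linarith)
  have c2 : n * (80 * n) ≤ n * m := by
    refine mul_le_mul_of_nonneg_left ?_ (by linarith)
    have : n * 81 ≤ n * ℓ := mul_le_mul_of_nonneg_left (by nlinarith) (by linarith)
    linarith
  have htot : m * (3 * n + ((k : ℤ) + 1) * R) + n * U * (2 * (k : ℤ) + (qB : ℕ) + ((k : ℤ) + 1) * R + La + 2) + 2 * n ≤ 9 * (n * m) := by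
    have e2 : n * U * (2 * (k : ℤ) + (qB : ℕ) + ((k : ℤ) + 1) * R + La + 2) = n * (U * (2 * (k : ℤ) + (qB : ℕ) + ((k : ℤ) + 1) * R + La + 2)) := by ring
    have e3 : m * (3 * n + ((k : ℤ) + 1) * R) = 3 * (n * m) + m * (((k : ℤ) + 1) * R) := by ring
    rw [e2, e3]
    nlinarith
  have := mul_le_mul_of_nonneg_left htot hu
  linarith

/-! ## §2 The transverse floors `FA5`/`FA6` (correlation bound `yBnd` at `(qB, RA′, k)`) -/

/-- **`FA5` at the (ζ′) y′-face tuple** (`k₀ := 3`; `i` the transverse index): the lower transverse reading of region `k` is above `−fw`, given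
`hlo : −fw + 9u₀ + 1 ≤ FcA yL`. [cite: KozmaNitzan2024, §4 Lemma 12 (pp. 23–25)] -/
theorem FA5_YA (κ : Consts) {V : Type} [DecidableEq V] [Countable V] {G : SimpleGraph V} [G.LocallyFinite] (Φ : PlanarSkeletonFrm G) (t : V) (p : unitInterval) (D : Skelφ.StepI.DataNS V) (g : ℕ) (f : ℕ) (P : PCells2T) (icr : Fin 2) (mk : ℕ) (hN : EqNumL κ Φ t p D g f) (hκ : (hL κ Φ t p D g f).natAbs ≤ 10 * nL κ Φ t p D g f)
    (hnA : 2000 * Neg.Kq κ * (KS0.R'0 κ Φ t p D mk + 2) ≤ nL κ Φ t p D g f) (hℓ : 22000 * Neg.Kq κ * (KS0.R'0 κ Φ t p D mk + 2) ≤ ℓL κ Φ t p D g f)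
    (yL x z : Site 2) (i : Fin 2) {qB : ℕ}
    (hqB : 4 * ((shearUnit (nL κ Φ t p D g f) (hL κ Φ t p D g f) : ℤ) * (qB : ℤ)) ≤ 5 * ((nL κ Φ t p D g f : ℤ) * ℓL κ Φ t p D g f))
    {k : ℕ} (hk : k + 1 ≤ 1000 * Neg.Kq κ)
    (hlo : -(5 * (P.r i : ℤ) - 4 - 3 - P.c icr - |z i - P.cenS x i|) + 9 * u₀A κ Φ t p D g f + 1 ≤ FcA κ Φ t p D g f yL) :
    (nL κ Φ t p D g f : ℤ) * modulus (nL κ Φ t p D g f) (hL κ Φ t p D g f) (vL κ Φ t p D g f) (vβL κ Φ t p D g f) *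
        (-(5 * (P.r i : ℤ) - 4 - 3 - P.c icr - |z i - P.cenS x i|) - FcA κ Φ t p D g f yL) ≤
      -(u₀A κ Φ t p D g f * (yBnd (nL κ Φ t p D g f) (ℓL κ Φ t p D g f) (hL κ Φ t p D g f)
            (modulus (nL κ Φ t p D g f) (hL κ Φ t p D g f) (vL κ Φ t p D g f) (vβL κ Φ t p D g f)) qB (KS0.R'0 κ Φ t p D mk) k +
          2 * (nL κ Φ t p D g f : ℤ))) -
        (nL κ Φ t p D g f : ℤ) * modulus (nL κ Φ t p D g f) (hL κ Φ t p D g f) (vL κ Φ t p D g f) (vβL κ Φ t p D g f) := by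
  obtain ⟨hn1, hℓ1⟩ := one_le_of_eqNumL κ Φ t p D g f hN
  have hm0 : 0 < modulus (nL κ Φ t p D g f) (hL κ Φ t p D g f) (vL κ Φ t p D g f) (vβL κ Φ t p D g f) := Skelφ.NegPrm.modulus_vβOf_pos hn1 hℓ1 _ _
  have hu : 1 ≤ u₀A κ Φ t p D g f := (units_eqA κ Φ t p D g f).2.2.2.2.1
  have hn : (1 : ℤ) ≤ (nL κ Φ t p D g f : ℤ) := by exact_mod_cast hn1
  have hB := yBnd_env_Y κ Φ t p D g f mk hN hκ hnA hℓ hqB hk (by linarith : 0 ≤ u₀A κ Φ t p D g f)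
  clear hℓ hk hκ hqB hnA
  set n : ℤ := (nL κ Φ t p D g f : ℤ)
  set m := modulus (nL κ Φ t p D g f) (hL κ Φ t p D g f) (vL κ Φ t p D g f) (vβL κ Φ t p D g f)
  set u := u₀A κ Φ t p D g f
  set F := FcA κ Φ t p D g f yL
  set B := yBnd (nL κ Φ t p D g f) (ℓL κ Φ t p D g f) (hL κ Φ t p D g f) m qB (KS0.R'0 κ Φ t p D mk) k
  set fw := 5 * (P.r i : ℤ) - 4 - 3 - P.c icr - |z i - P.cenS x i|
  have hnm : 0 ≤ n * m := mul_nonneg (by linarith) hm0.le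
  have h1 : n * m * (-fw - F) ≤ n * m * (-(9 * u) - 1) := mul_le_mul_of_nonneg_left (by linarith) hnm
  nlinarith [h1, hB, hnm]

/-- **`FA6` at the (ζ′) y′-face tuple** (`k₀ := 3`): the upper transverse reading of region `k` is below `fw`, given `hhi : FcA yL + 9u₀ + 1 ≤ fw`.
[cite: KozmaNitzan2024, §4 Lemma 12 (pp. 23–25)] -/
theorem FA6_YA (κ : Consts) {V : Type} [DecidableEq V] [Countable V] {G : SimpleGraph V} [G.LocallyFinite] (Φ : PlanarSkeletonFrm G) (t : V) (p : unitInterval) (D : Skelφ.StepI.DataNS V) (g : ℕ) (f : ℕ) (P : PCells2T) (icr : Fin 2) (mk : ℕ) (hN : EqNumL κ Φ t p D g f) (hκ : (hL κ Φ t p D g f).natAbs ≤ 10 * nL κ Φ t p D g f)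
    (hnA : 2000 * Neg.Kq κ * (KS0.R'0 κ Φ t p D mk + 2) ≤ nL κ Φ t p D g f) (hℓ : 22000 * Neg.Kq κ * (KS0.R'0 κ Φ t p D mk + 2) ≤ ℓL κ Φ t p D g f)
    (yL x z : Site 2) (i : Fin 2) {qB : ℕ}
    (hqB : 4 * ((shearUnit (nL κ Φ t p D g f) (hL κ Φ t p D g f) : ℤ) * (qB : ℤ)) ≤ 5 * ((nL κ Φ t p D g f : ℤ) * ℓL κ Φ t p D g f))
    {k : ℕ} (hk : k + 1 ≤ 1000 * Neg.Kq κ)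
    (hhi : FcA κ Φ t p D g f yL + 9 * u₀A κ Φ t p D g f + 1 ≤ 5 * (P.r i : ℤ) - 4 - 3 - P.c icr - |z i - P.cenS x i|) :
    (nL κ Φ t p D g f : ℤ) * modulus (nL κ Φ t p D g f) (hL κ Φ t p D g f) (vL κ Φ t p D g f) (vβL κ Φ t p D g f) * (FcA κ Φ t p D g f yL + 1) +
        u₀A κ Φ t p D g f * (yBnd (nL κ Φ t p D g f) (ℓL κ Φ t p D g f) (hL κ Φ t p D g f)
            (modulus (nL κ Φ t p D g f) (hL κ Φ t p D g f) (vL κ Φ t p D g f) (vβL κ Φ t p D g f)) qB (KS0.R'0 κ Φ t p D mk) k +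
          (nL κ Φ t p D g f : ℤ)) ≤
      (nL κ Φ t p D g f : ℤ) * modulus (nL κ Φ t p D g f) (hL κ Φ t p D g f) (vL κ Φ t p D g f) (vβL κ Φ t p D g f) *
        (5 * (P.r i : ℤ) - 4 - 3 - P.c icr - |z i - P.cenS x i|) := by
  obtain ⟨hn1, hℓ1⟩ := one_le_of_eqNumL κ Φ t p D g f hN
  have hm0 : 0 < modulus (nL κ Φ t p D g f) (hL κ Φ t p D g f) (vL κ Φ t p D g f) (vβL κ Φ t p D g f) := Skelφ.NegPrm.modulus_vβOf_pos hn1 hℓ1 _ _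
  have hu : 1 ≤ u₀A κ Φ t p D g f := (units_eqA κ Φ t p D g f).2.2.2.2.1
  have hn : (1 : ℤ) ≤ (nL κ Φ t p D g f : ℤ) := by exact_mod_cast hn1
  have hB := yBnd_env_Y κ Φ t p D g f mk hN hκ hnA hℓ hqB hk (by linarith : 0 ≤ u₀A κ Φ t p D g f)
  clear hℓ hk hκ hqB hnA
  set n : ℤ := (nL κ Φ t p D g f : ℤ)
  set m := modulus (nL κ Φ t p D g f) (hL κ Φ t p D g f) (vL κ Φ t p D g f) (vβL κ Φ t p D g f)
  set u := u₀A κ Φ t p D g f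
  set F := FcA κ Φ t p D g f yL
  set B := yBnd (nL κ Φ t p D g f) (ℓL κ Φ t p D g f) (hL κ Φ t p D g f) m qB (KS0.R'0 κ Φ t p D mk) k
  set fw := 5 * (P.r i : ℤ) - 4 - 3 - P.c icr - |z i - P.cenS x i|
  have hnm : 0 ≤ n * m := mul_nonneg (by linarith) hm0.le
  have h1 : n * m * (F + 9 * u + 1) ≤ n * m * fw := mul_le_mul_of_nonneg_left hhi hnm
  have hun : 0 ≤ u * n := mul_nonneg (by linarith) (by linarith)
  nlinarith [h1, hB, hnm, hun]

end FloorsBY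

end KS

end NegB

end PlanarSkeletonFrm

end Summit.CriticalPhenomena.PercolationContinuityZ3.Theorems.Transplant

end
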